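import Mathlib
import HarnessLib
import Summits.ValiantsHypothesis.ValiantsHypothesis.Theorems.LacunarySymmetroidMatrixDescartesProductPlusOneRowTowerKLetterImage
import Summits.ValiantsHypothesis.ValiantsHypothesis.Theorems.LacunarySymmetroidMatrixDescartesProductPlusOneRowTowerKLine
import Summits.ValiantsHypothesis.ValiantsHypothesis.Theorems.LacunarySymmetroidMatrixDescartesProductPlusOneSixthOrderRowLaws
import Summits.ValiantsHypothesis.ValiantsHypothesis.Theorems.LacunarySymmetroidMatrixDescartesProductPlusOneSlowKneeCellRateFree

/-!
# LINE (A) `product_plus_one` (crux `MatrixDescartes`, stmt-ValiantsHypothesis-18050, V1) — W-CB §30, THE BINOMIAL ROWS OF THE ORDER-6 IMAGE CELL (K = 3):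
# E3b's six letter rows (slow knee free, three poles with root outside, middle/fast knees off their ring) have a POSITIVE order-8 image on the window,
# in the every-K tower currency — so they enter the cloud cell ✓⧗ `sixthOrderCloudCell_wronskian_roots_le_six` through its (IMG) branch

`K = 3`, support `d 0 < d 1 < d 2` with `3(d1−d0) ≤ d2−d0` (`2p ≤ s`, `p = d1−d0`, `s = d2−d1`); window `(u,v)`, `0 < u`; ONE row `b : Fin 3 → ℝ`,
`f = Σ_l C (b l) X^{d l}`; every-K tower at `n = 1` (`lam = (p, p+s)`, `A = b 0`, `B = (−b 1, −b 2)`); image `ψ₇ − e₁ψ₅ + e₂ψ₃ − e₃ψ₁`, `eᵢ` of `p², s², (p+s)²`.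
★ `sixthOrder_letterRow_image_pos` — if the row is one of
 (K01) `b 2 = 0 ∧ 0 < b 0·b 1` (slow knee);  (P01) `b 2 = 0 ∧ b 0·b 1 < 0 ∧ 0 ≤ f(u)f(v)` (slow pole, root outside);
 (K12) `b 0 = 0 ∧ 0 < b 1·b 2 ∧ ∀ x ∈ (u,v), 0 < 6(s−p)(2s−p)(2s+p)(3s+p) + 240(3s+p)(2s−p)·ψ₁ + 5040·ψ₁²` (middle knee off its ring);
 (P12) `b 0 = 0 ∧ b 1·b 2 < 0 ∧ 0 ≤ f(u)f(v)`;  (K02) `b 1 = 0 ∧ 0 < b 0·b 2 ∧ ∀ x ∈ (u,v), 0 < c₀(p+s) + c₁(p+s)·ψ₁ + 5040·ψ₁²` (fast knee off its ring);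
 (P02) `b 1 = 0 ∧ b 0·b 2 < 0 ∧ 0 ≤ f(u)f(v)`,
then on the window the stripped row `b 0 + b 1 x^{d1−d0} + b 2 x^{d2−d0}` is non-zero and the image is `> 0`.  INGREDIENTS: ✓⧗ `rowPsiK_image8_single_eq` /
`…_pair_eq` (image = `Λ(λ²)ψ₁ + ψ₁²(c₂ + c₃ψ₁ + 5040ψ₁²)`, val-lit-p5 g17), `Λ(λ²) = 0` at the three rates (`ring`), the pure-real sign theorems of ✓ E1
`…SixthOrderRowLaws` (val-lit-p7 g18: `sixthOrder_pole_slow_pos`, `sixthOrder_pole_mid_pos`, `sixthOrder_pole_fast_pos`), ✓ `rowPsiK1_single_pos/neg`,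
✓ `rowPsiK1_pair_pos/neg`, ✓ `binomial_ne_zero_of_endpoints`.  This is E3b's per-row content (`sixthOrder_row_facts`, binomial tower) re-keyed to the every-K
tower, so that ONE cell takes binomial rows AND clouds.

HONEST FRAMING: per-row facts (helper); nothing about `WronskianBudgetK3` / `OneChangeFloorK3` / 18050 / `MatrixDescartes`; `VP ≠ VNP` is NOT proved.
No definitions, no named facts, no sorry.
-/

set_option linter.dupNamespace false

namespace Summit.ValiantsHypothesis.ValiantsHypothesis.Theorems.LacunarySymmetroidMatrixDescartes

namespace ProductPlusOne

open Finset Set Polynomial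
open scoped BigOperators Polynomial

/-- ★ **The six binomial rows have a positive order-8 image** (K = 3, every-K tower at `n = 1`; menu (K01)…(P02) of the module docstring).
[this file's theorem] -/
theorem sixthOrder_letterRow_image_pos (d : Fin 3 → ℕ) (hd : StrictMono d) (h3 : 3 * (d 1 - d 0) ≤ d 2 - d 0)
    (b : Fin 3 → ℝ) {u v : ℝ} (hu : 0 < u)
    (hrow :
      (b 2 = 0 ∧ 0 < b 0 * b 1) ∨
      (b 2 = 0 ∧ b 0 * b 1 < 0 ∧
          0 ≤ (∑ l, C (b l) * X ^ (d l) : ℝ[X]).eval u * (∑ l, C (b l) * X ^ (d l) : ℝ[X]).eval v) ∨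
      (b 0 = 0 ∧ 0 < b 1 * b 2 ∧ ∀ x ∈ Ioo u v,
          0 < 6 * (((((d 2 - d 0 : ℕ) : ℝ) - ((d 1 - d 0 : ℕ) : ℝ)) - ((d 1 - d 0 : ℕ) : ℝ))
                * (2 * (((d 2 - d 0 : ℕ) : ℝ) - ((d 1 - d 0 : ℕ) : ℝ)) - ((d 1 - d 0 : ℕ) : ℝ))
                * (2 * (((d 2 - d 0 : ℕ) : ℝ) - ((d 1 - d 0 : ℕ) : ℝ)) + ((d 1 - d 0 : ℕ) : ℝ))
                * (3 * (((d 2 - d 0 : ℕ) : ℝ) - ((d 1 - d 0 : ℕ) : ℝ)) + ((d 1 - d 0 : ℕ) : ℝ)))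
            + 240 * ((3 * (((d 2 - d 0 : ℕ) : ℝ) - ((d 1 - d 0 : ℕ) : ℝ)) + ((d 1 - d 0 : ℕ) : ℝ))
                * (2 * (((d 2 - d 0 : ℕ) : ℝ) - ((d 1 - d 0 : ℕ) : ℝ)) - ((d 1 - d 0 : ℕ) : ℝ)))
                * rowPsiK1 (fun l : Fin 2 => d l.succ - d 0) (b 0) (fun l : Fin 2 => -(b l.succ)) x
            + 5040 * rowPsiK1 (fun l : Fin 2 => d l.succ - d 0) (b 0) (fun l : Fin 2 => -(b l.succ)) x ^ 2) ∨
      (b 0 = 0 ∧ b 1 * b 2 < 0 ∧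
          0 ≤ (∑ l, C (b l) * X ^ (d l) : ℝ[X]).eval u * (∑ l, C (b l) * X ^ (d l) : ℝ[X]).eval v) ∨
      (b 1 = 0 ∧ 0 < b 0 * b 2 ∧ ∀ x ∈ Ioo u v,
          0 < 6 * (12 * ((d 1 - d 0 : ℕ) : ℝ) ^ 4 + 56 * ((d 1 - d 0 : ℕ) : ℝ) ^ 3 * (((d 2 - d 0 : ℕ) : ℝ) - ((d 1 - d 0 : ℕ) : ℝ))
                + 89 * ((d 1 - d 0 : ℕ) : ℝ) ^ 2 * (((d 2 - d 0 : ℕ) : ℝ) - ((d 1 - d 0 : ℕ) : ℝ)) ^ 2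
                + 56 * ((d 1 - d 0 : ℕ) : ℝ) * (((d 2 - d 0 : ℕ) : ℝ) - ((d 1 - d 0 : ℕ) : ℝ)) ^ 3
                + 12 * (((d 2 - d 0 : ℕ) : ℝ) - ((d 1 - d 0 : ℕ) : ℝ)) ^ 4)
            + 120 * (12 * ((d 1 - d 0 : ℕ) : ℝ) ^ 2 + 26 * ((d 1 - d 0 : ℕ) : ℝ) * (((d 2 - d 0 : ℕ) : ℝ) - ((d 1 - d 0 : ℕ) : ℝ))
                + 12 * (((d 2 - d 0 : ℕ) : ℝ) - ((d 1 - d 0 : ℕ) : ℝ)) ^ 2)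
                * rowPsiK1 (fun l : Fin 2 => d l.succ - d 0) (b 0) (fun l : Fin 2 => -(b l.succ)) x
            + 5040 * rowPsiK1 (fun l : Fin 2 => d l.succ - d 0) (b 0) (fun l : Fin 2 => -(b l.succ)) x ^ 2) ∨
      (b 1 = 0 ∧ b 0 * b 2 < 0 ∧
          0 ≤ (∑ l, C (b l) * X ^ (d l) : ℝ[X]).eval u * (∑ l, C (b l) * X ^ (d l) : ℝ[X]).eval v))
    {x : ℝ} (hx : x ∈ Ioo u v) :
    b 0 + b 1 * x ^ (d 1 - d 0) + b 2 * x ^ (d 2 - d 0) ≠ 0 ∧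
    0 < rowPsiK7 (fun l : Fin 2 => d l.succ - d 0) (b 0) (fun l : Fin 2 => -(b l.succ)) x
        - (((d 1 - d 0 : ℕ) : ℝ) ^ 2 + (((d 2 - d 0 : ℕ) : ℝ) - ((d 1 - d 0 : ℕ) : ℝ)) ^ 2 + ((d 2 - d 0 : ℕ) : ℝ) ^ 2)
            * rowPsiK5 (fun l : Fin 2 => d l.succ - d 0) (b 0) (fun l : Fin 2 => -(b l.succ)) x
        + (((d 1 - d 0 : ℕ) : ℝ) ^ 2 * (((d 2 - d 0 : ℕ) : ℝ) - ((d 1 - d 0 : ℕ) : ℝ)) ^ 2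
              + ((d 1 - d 0 : ℕ) : ℝ) ^ 2 * ((d 2 - d 0 : ℕ) : ℝ) ^ 2
              + (((d 2 - d 0 : ℕ) : ℝ) - ((d 1 - d 0 : ℕ) : ℝ)) ^ 2 * ((d 2 - d 0 : ℕ) : ℝ) ^ 2)
            * rowPsiK3 (fun l : Fin 2 => d l.succ - d 0) (b 0) (fun l : Fin 2 => -(b l.succ)) x
        - (((d 1 - d 0 : ℕ) : ℝ) ^ 2 * (((d 2 - d 0 : ℕ) : ℝ) - ((d 1 - d 0 : ℕ) : ℝ)) ^ 2 * ((d 2 - d 0 : ℕ) : ℝ) ^ 2)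
            * rowPsiK1 (fun l : Fin 2 => d l.succ - d 0) (b 0) (fun l : Fin 2 => -(b l.succ)) x := by
  classical
  have h01 : d 0 < d 1 := hd (by decide)
  have h12 : d 1 < d 2 := hd (by decide)
  have hx0 : 0 < x := hu.trans hx.1
  have hv : 0 < v := hu.trans (hx.1.trans hx.2)
  set lam : Fin 2 → ℕ := fun l : Fin 2 => d l.succ - d 0 with hlam
  set B : Fin 2 → ℝ := fun l : Fin 2 => -(b l.succ) with hBdef
  have hlam0 : lam 0 = d 1 - d 0 := rfl
  have hlam1 : lam 1 = d 2 - d 0 := rfl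
  have hl0 : lam 0 ≠ 0 := by rw [hlam0]; omega
  have hl1 : lam 1 ≠ 0 := by rw [hlam1]; omega
  have hl01 : lam 0 ≠ lam 1 := by rw [hlam0, hlam1]; omega
  -- real rates
  obtain ⟨p, hp⟩ : ∃ p : ℝ, ((d 1 - d 0 : ℕ) : ℝ) = p := ⟨_, rfl⟩
  obtain ⟨c, hc⟩ : ∃ c : ℝ, ((d 2 - d 0 : ℕ) : ℝ) = c := ⟨_, rfl⟩
  have hppos : 0 < p := by rw [← hp]; exact_mod_cast Nat.sub_pos_of_lt h01
  have h2ps : 2 * p ≤ c - p := by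
    have h : ((3 * (d 1 - d 0) : ℕ) : ℝ) ≤ ((d 2 - d 0 : ℕ) : ℝ) := by exact_mod_cast h3
    push_cast at h; rw [hp, hc] at h; linarith
  have hspos : 0 < c - p := by linarith
  have hps : p ≤ c - p := by linarith
  -- the stripped row in the two spellings and the row polynomial at a point
  have hstrip : ∀ y, b 0 - ∑ l : Fin 2, B l * y ^ (lam l) = b 0 + b 1 * y ^ (d 1 - d 0) + b 2 * y ^ (d 2 - d 0) := by
    intro y; simp only [hBdef, Fin.sum_univ_two, hlam0, hlam1, Fin.succ_zero_eq_one, Fin.succ_one_eq_two]; ring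
  have hd0 : ∀ l, d 0 ≤ d l := fun l => hd.monotone (Fin.zero_le l)
  have hev : ∀ y, (∑ l, C (b l) * X ^ (d l) : ℝ[X]).eval y = y ^ (d 0) * (b 0 + b 1 * y ^ (d 1 - d 0) + b 2 * y ^ (d 2 - d 0)) := by
    intro y
    rw [eval_rowK_eq d hd0 b y]
    simp only [Fin.sum_univ_succ, Fin.sum_univ_zero, Fin.succ_zero_eq_one, Fin.succ_one_eq_two]; ring
  -- endpoint product of the stripped row from `0 ≤ f(u)f(v)`
  have hend_strip : 0 ≤ (∑ l, C (b l) * X ^ (d l) : ℝ[X]).eval u * (∑ l, C (b l) * X ^ (d l) : ℝ[X]).eval v →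
      0 ≤ (b 0 + b 1 * u ^ (d 1 - d 0) + b 2 * u ^ (d 2 - d 0)) * (b 0 + b 1 * v ^ (d 1 - d 0) + b 2 * v ^ (d 2 - d 0)) := by
    intro hend
    rw [hev, hev] at hend
    have hpow : 0 < u ^ (d 0) * v ^ (d 0) := mul_pos (pow_pos hu _) (pow_pos hv _)
    have : u ^ (d 0) * (b 0 + b 1 * u ^ (d 1 - d 0) + b 2 * u ^ (d 2 - d 0)) * (v ^ (d 0) * (b 0 + b 1 * v ^ (d 1 - d 0) + b 2 * v ^ (d 2 - d 0)))
        = (u ^ (d 0) * v ^ (d 0)) * ((b 0 + b 1 * u ^ (d 1 - d 0) + b 2 * u ^ (d 2 - d 0)) * (b 0 + b 1 * v ^ (d 1 - d 0) + b 2 * v ^ (d 2 - d 0))) := by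
      ring
    rw [this] at hend
    exact (mul_nonneg_iff_of_pos_left hpow).1 hend
  -- the three roots of `Λ`
  have hrootP : p ^ 6 - (p ^ 2 + (c - p) ^ 2 + c ^ 2) * p ^ 4 + (p ^ 2 * (c - p) ^ 2 + p ^ 2 * c ^ 2 + (c - p) ^ 2 * c ^ 2) * p ^ 2
      - p ^ 2 * (c - p) ^ 2 * c ^ 2 = 0 := by ring
  have hrootC : c ^ 6 - (p ^ 2 + (c - p) ^ 2 + c ^ 2) * c ^ 4 + (p ^ 2 * (c - p) ^ 2 + p ^ 2 * c ^ 2 + (c - p) ^ 2 * c ^ 2) * c ^ 2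
      - p ^ 2 * (c - p) ^ 2 * c ^ 2 = 0 := by ring
  have hrootS : (c - p) ^ 6 - (p ^ 2 + (c - p) ^ 2 + c ^ 2) * (c - p) ^ 4
      + (p ^ 2 * (c - p) ^ 2 + p ^ 2 * c ^ 2 + (c - p) ^ 2 * c ^ 2) * (c - p) ^ 2 - p ^ 2 * (c - p) ^ 2 * c ^ 2 = 0 := by ring
  rw [hp, hc] at hrow ⊢
  have hcast0 : ((lam 0 : ℕ) : ℝ) = p := by rw [hlam0]; exact hp
  have hcast1 : ((lam 1 : ℕ) : ℝ) = c := by rw [hlam1]; exact hc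
  rcases hrow with ⟨hb2, hk⟩ | ⟨hb2, hpl, hend⟩ | ⟨hb0, hk, hring⟩ | ⟨hb0, hpl, hend⟩ | ⟨hb1, hk, hring⟩ | ⟨hb1, hpl, hend⟩
  · -- (K01) slow knee: single tail letter 0, `A·B₀ < 0`
    have hB : ∀ l, l ≠ (0 : Fin 2) → B l = 0 := by
      intro l hl; fin_cases l
      · exact absurd rfl hl
      · simp [hBdef, hb2]
    have hne : b 0 + b 1 * x ^ (d 1 - d 0) + b 2 * x ^ (d 2 - d 0) ≠ 0 := by
      rw [hb2, zero_mul, add_zero]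
      rcases pos_and_pos_or_neg_and_neg_of_mul_pos hk with ⟨h0, h1⟩ | ⟨h0, h1⟩
      · have : 0 < b 1 * x ^ (d 1 - d 0) := mul_pos h1 (pow_pos hx0 _); linarith
      · have : b 1 * x ^ (d 1 - d 0) < 0 := mul_neg_of_neg_of_pos h1 (pow_pos hx0 _); linarith
    have hF : b 0 - ∑ l : Fin 2, B l * x ^ (lam l) ≠ 0 := by rw [hstrip]; exact hne
    refine ⟨hne, ?_⟩
    have hψ : rowPsiK1 lam (b 0) B x < 0 :=
      rowPsiK1_single_neg lam (b 0) B 0 hB hx0 hl0 (by simp only [hBdef, Fin.succ_zero_eq_one, mul_neg]; exact neg_lt_zero.2 hk) hF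
    rw [rowPsiK_image8_single_eq lam (b 0) B 0 hB, hcast0, hrootP, zero_mul, zero_add]
    have hQ := sixthOrder_pole_slow_pos hppos h2ps hψ.ne
    have e : rowPsiK1 lam (b 0) B x ^ 2 * ((126 * p ^ 4 - 30 * (p ^ 2 + (c - p) ^ 2 + c ^ 2) * p ^ 2
          + 6 * (p ^ 2 * (c - p) ^ 2 + p ^ 2 * c ^ 2 + (c - p) ^ 2 * c ^ 2))
        + (1680 * p ^ 2 - 120 * (p ^ 2 + (c - p) ^ 2 + c ^ 2)) * rowPsiK1 lam (b 0) B x + 5040 * rowPsiK1 lam (b 0) B x ^ 2)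
        = 6 * (((c - p) - p) * ((c - p) - 2 * p) * ((c - p) + 2 * p) * ((c - p) + 3 * p)) * rowPsiK1 lam (b 0) B x ^ 2
          + (-(240 * (((c - p) + 3 * p) * ((c - p) - 2 * p)))) * rowPsiK1 lam (b 0) B x ^ 3 + 5040 * rowPsiK1 lam (b 0) B x ^ 4 := by ring
    rw [e]; exact hQ
  · -- (P01) slow pole: single tail letter 0, `A·B₀ > 0`, root outside
    have hB : ∀ l, l ≠ (0 : Fin 2) → B l = 0 := by
      intro l hl; fin_cases l
      · exact absurd rfl hl
      · simp [hBdef, hb2]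
    have hb1 : b 1 ≠ 0 := fun h => by rw [h, mul_zero] at hpl; exact lt_irrefl _ hpl
    have hne : b 0 + b 1 * x ^ (d 1 - d 0) + b 2 * x ^ (d 2 - d 0) ≠ 0 := by
      have hend' := hend_strip hend
      rw [hb2, zero_mul, add_zero, zero_mul, add_zero] at hend'
      rw [hb2, zero_mul, add_zero]
      exact binomial_ne_zero_of_endpoints (b 0) (b 1) (by omega) hu hx hend' hb1
    have hF : b 0 - ∑ l : Fin 2, B l * x ^ (lam l) ≠ 0 := by rw [hstrip]; exact hne
    refine ⟨hne, ?_⟩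
    have hψ : 0 < rowPsiK1 lam (b 0) B x :=
      rowPsiK1_single_pos lam (b 0) B 0 hB hx0 hl0 (by simp only [hBdef, Fin.succ_zero_eq_one, mul_neg]; exact neg_pos.2 hpl) hF
    rw [rowPsiK_image8_single_eq lam (b 0) B 0 hB, hcast0, hrootP, zero_mul, zero_add]
    have hQ := sixthOrder_pole_slow_pos hppos h2ps hψ.ne'
    have e : rowPsiK1 lam (b 0) B x ^ 2 * ((126 * p ^ 4 - 30 * (p ^ 2 + (c - p) ^ 2 + c ^ 2) * p ^ 2
          + 6 * (p ^ 2 * (c - p) ^ 2 + p ^ 2 * c ^ 2 + (c - p) ^ 2 * c ^ 2))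
        + (1680 * p ^ 2 - 120 * (p ^ 2 + (c - p) ^ 2 + c ^ 2)) * rowPsiK1 lam (b 0) B x + 5040 * rowPsiK1 lam (b 0) B x ^ 2)
        = 6 * (((c - p) - p) * ((c - p) - 2 * p) * ((c - p) + 2 * p) * ((c - p) + 3 * p)) * rowPsiK1 lam (b 0) B x ^ 2
          + (-(240 * (((c - p) + 3 * p) * ((c - p) - 2 * p)))) * rowPsiK1 lam (b 0) B x ^ 3 + 5040 * rowPsiK1 lam (b 0) B x ^ 4 := by ring
    rw [e]; exact hQ
  · -- (K12) middle knee: `A = 0`, two tail letters, ring missed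
    have hB : ∀ l, l ≠ (0 : Fin 2) → l ≠ (1 : Fin 2) → B l = 0 := by intro l h0 h1; fin_cases l <;> simp_all
    have hne : b 0 + b 1 * x ^ (d 1 - d 0) + b 2 * x ^ (d 2 - d 0) ≠ 0 := by
      rw [hb0, zero_add]
      rcases pos_and_pos_or_neg_and_neg_of_mul_pos hk with ⟨h1, h2⟩ | ⟨h1, h2⟩
      · have := mul_pos h1 (pow_pos hx0 (d 1 - d 0)); have := mul_pos h2 (pow_pos hx0 (d 2 - d 0)); linarith
      · have := mul_neg_of_neg_of_pos h1 (pow_pos hx0 (d 1 - d 0))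
        have := mul_neg_of_neg_of_pos h2 (pow_pos hx0 (d 2 - d 0)); linarith
    have hF : (0 : ℝ) - ∑ l : Fin 2, B l * x ^ (lam l) ≠ 0 := by
      have h := hne; rw [← hstrip, hb0] at h; exact h
    refine ⟨hne, ?_⟩
    have hψ : rowPsiK1 lam 0 B x < 0 :=
      rowPsiK1_pair_neg lam B 0 1 (by decide) hB hx0 hl01 (by simp only [hBdef, Fin.succ_zero_eq_one, Fin.succ_one_eq_two, neg_mul_neg]; exact hk) hF
    have hr := hring x hx
    rw [hb0] at hr ⊢
    rw [rowPsiK_image8_pair_eq lam B 0 1 (by decide) hB (p ^ 2 + (c - p) ^ 2 + c ^ 2)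
      (p ^ 2 * (c - p) ^ 2 + p ^ 2 * c ^ 2 + (c - p) ^ 2 * c ^ 2) (p ^ 2 * (c - p) ^ 2 * c ^ 2) hF,
      hcast0, hcast1, hrootS, zero_mul, zero_add]
    have e : rowPsiK1 lam 0 B x ^ 2 * ((126 * (c - p) ^ 4 - 30 * (p ^ 2 + (c - p) ^ 2 + c ^ 2) * (c - p) ^ 2
          + 6 * (p ^ 2 * (c - p) ^ 2 + p ^ 2 * c ^ 2 + (c - p) ^ 2 * c ^ 2))
        + (1680 * (c - p) ^ 2 - 120 * (p ^ 2 + (c - p) ^ 2 + c ^ 2)) * rowPsiK1 lam 0 B x + 5040 * rowPsiK1 lam 0 B x ^ 2)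
        = rowPsiK1 lam 0 B x ^ 2 * (6 * (((c - p) - p) * (2 * (c - p) - p) * (2 * (c - p) + p) * (3 * (c - p) + p))
          + 240 * ((3 * (c - p) + p) * (2 * (c - p) - p)) * rowPsiK1 lam 0 B x + 5040 * rowPsiK1 lam 0 B x ^ 2) := by ring
    rw [e]; exact mul_pos (by rw [pow_two]; exact mul_pos_of_neg_of_neg hψ hψ) hr
  · -- (P12) middle pole: `A = 0`, two tail letters, root outside
    have hB : ∀ l, l ≠ (0 : Fin 2) → l ≠ (1 : Fin 2) → B l = 0 := by intro l h0 h1; fin_cases l <;> simp_all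
    have hb2 : b 2 ≠ 0 := fun h => by rw [h, mul_zero] at hpl; exact lt_irrefl _ hpl
    have hne : b 0 + b 1 * x ^ (d 1 - d 0) + b 2 * x ^ (d 2 - d 0) ≠ 0 := by
      have hend' := hend_strip hend
      rw [hb0, zero_add, zero_add] at hend'
      rw [hb0, zero_add]
      -- factor `y^{d1−d0}`: `b 1 y^{d1−d0} + b 2 y^{d2−d0} = y^{d1−d0}(b 1 + b 2 y^{d2−d1})`
      have hsplit : ∀ y : ℝ, b 1 * y ^ (d 1 - d 0) + b 2 * y ^ (d 2 - d 0) = y ^ (d 1 - d 0) * (b 1 + b 2 * y ^ (d 2 - d 1)) := by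
        intro y
        have : d 2 - d 0 = (d 1 - d 0) + (d 2 - d 1) := by omega
        rw [this, pow_add]; ring
      rw [hsplit, hsplit] at hend'
      have hpow : 0 < u ^ (d 1 - d 0) * v ^ (d 1 - d 0) := mul_pos (pow_pos hu _) (pow_pos hv _)
      have h' : 0 ≤ (b 1 + b 2 * u ^ (d 2 - d 1)) * (b 1 + b 2 * v ^ (d 2 - d 1)) := by
        have : u ^ (d 1 - d 0) * (b 1 + b 2 * u ^ (d 2 - d 1)) * (v ^ (d 1 - d 0) * (b 1 + b 2 * v ^ (d 2 - d 1)))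
            = (u ^ (d 1 - d 0) * v ^ (d 1 - d 0)) * ((b 1 + b 2 * u ^ (d 2 - d 1)) * (b 1 + b 2 * v ^ (d 2 - d 1))) := by ring
        rw [this] at hend'
        exact (mul_nonneg_iff_of_pos_left hpow).1 hend'
      rw [hsplit]
      exact mul_ne_zero (pow_ne_zero _ hx0.ne') (binomial_ne_zero_of_endpoints (b 1) (b 2) (by omega) hu hx h' hb2)
    have hF : (0 : ℝ) - ∑ l : Fin 2, B l * x ^ (lam l) ≠ 0 := by
      have h := hne; rw [← hstrip, hb0] at h; exact h
    refine ⟨hne, ?_⟩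
    have hψ : 0 < rowPsiK1 lam 0 B x :=
      rowPsiK1_pair_pos lam B 0 1 (by decide) hB hx0 hl01 (by simp only [hBdef, Fin.succ_zero_eq_one, Fin.succ_one_eq_two, neg_mul_neg]; exact hpl) hF
    rw [hb0]
    rw [rowPsiK_image8_pair_eq lam B 0 1 (by decide) hB (p ^ 2 + (c - p) ^ 2 + c ^ 2)
      (p ^ 2 * (c - p) ^ 2 + p ^ 2 * c ^ 2 + (c - p) ^ 2 * c ^ 2) (p ^ 2 * (c - p) ^ 2 * c ^ 2) hF,
      hcast0, hcast1, hrootS, zero_mul, zero_add]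
    have hQ := sixthOrder_pole_mid_pos hppos hps hψ
    have e : rowPsiK1 lam 0 B x ^ 2 * ((126 * (c - p) ^ 4 - 30 * (p ^ 2 + (c - p) ^ 2 + c ^ 2) * (c - p) ^ 2
          + 6 * (p ^ 2 * (c - p) ^ 2 + p ^ 2 * c ^ 2 + (c - p) ^ 2 * c ^ 2))
        + (1680 * (c - p) ^ 2 - 120 * (p ^ 2 + (c - p) ^ 2 + c ^ 2)) * rowPsiK1 lam 0 B x + 5040 * rowPsiK1 lam 0 B x ^ 2)
        = 6 * (((c - p) - p) * (2 * (c - p) - p) * (2 * (c - p) + p) * (3 * (c - p) + p)) * rowPsiK1 lam 0 B x ^ 2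
          + 240 * ((3 * (c - p) + p) * (2 * (c - p) - p)) * rowPsiK1 lam 0 B x ^ 3 + 5040 * rowPsiK1 lam 0 B x ^ 4 := by ring
    rw [e]; exact hQ
  · -- (K02) fast knee: single tail letter 1, ring missed
    have hB : ∀ l, l ≠ (1 : Fin 2) → B l = 0 := by
      intro l hl; fin_cases l
      · simp [hBdef, hb1]
      · exact absurd rfl hl
    have hne : b 0 + b 1 * x ^ (d 1 - d 0) + b 2 * x ^ (d 2 - d 0) ≠ 0 := by
      rw [hb1, zero_mul, add_zero]
      rcases pos_and_pos_or_neg_and_neg_of_mul_pos hk with ⟨h0, h2⟩ | ⟨h0, h2⟩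
      · have : 0 < b 2 * x ^ (d 2 - d 0) := mul_pos h2 (pow_pos hx0 _); linarith
      · have : b 2 * x ^ (d 2 - d 0) < 0 := mul_neg_of_neg_of_pos h2 (pow_pos hx0 _); linarith
    have hF : b 0 - ∑ l : Fin 2, B l * x ^ (lam l) ≠ 0 := by rw [hstrip]; exact hne
    refine ⟨hne, ?_⟩
    have hψ : rowPsiK1 lam (b 0) B x < 0 :=
      rowPsiK1_single_neg lam (b 0) B 1 hB hx0 hl1 (by simp only [hBdef, Fin.succ_one_eq_two, mul_neg]; exact neg_lt_zero.2 hk) hF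
    have hr := hring x hx
    rw [rowPsiK_image8_single_eq lam (b 0) B 1 hB, hcast1, hrootC, zero_mul, zero_add]
    have e : rowPsiK1 lam (b 0) B x ^ 2 * ((126 * c ^ 4 - 30 * (p ^ 2 + (c - p) ^ 2 + c ^ 2) * c ^ 2
          + 6 * (p ^ 2 * (c - p) ^ 2 + p ^ 2 * c ^ 2 + (c - p) ^ 2 * c ^ 2))
        + (1680 * c ^ 2 - 120 * (p ^ 2 + (c - p) ^ 2 + c ^ 2)) * rowPsiK1 lam (b 0) B x + 5040 * rowPsiK1 lam (b 0) B x ^ 2)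
        = rowPsiK1 lam (b 0) B x ^ 2 * (6 * (12 * p ^ 4 + 56 * p ^ 3 * (c - p) + 89 * p ^ 2 * (c - p) ^ 2 + 56 * p * (c - p) ^ 3 + 12 * (c - p) ^ 4)
          + 120 * (12 * p ^ 2 + 26 * p * (c - p) + 12 * (c - p) ^ 2) * rowPsiK1 lam (b 0) B x + 5040 * rowPsiK1 lam (b 0) B x ^ 2) := by
      ring
    rw [e]; exact mul_pos (by rw [pow_two]; exact mul_pos_of_neg_of_neg hψ hψ) hr
  · -- (P02) fast pole: single tail letter 1, root outside
    have hB : ∀ l, l ≠ (1 : Fin 2) → B l = 0 := by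
      intro l hl; fin_cases l
      · simp [hBdef, hb1]
      · exact absurd rfl hl
    have hb2 : b 2 ≠ 0 := fun h => by rw [h, mul_zero] at hpl; exact lt_irrefl _ hpl
    have hne : b 0 + b 1 * x ^ (d 1 - d 0) + b 2 * x ^ (d 2 - d 0) ≠ 0 := by
      have hend' := hend_strip hend
      rw [hb1, zero_mul, add_zero, zero_mul, add_zero] at hend'
      rw [hb1, zero_mul, add_zero]
      exact binomial_ne_zero_of_endpoints (b 0) (b 2) (by omega) hu hx hend' hb2
    have hF : b 0 - ∑ l : Fin 2, B l * x ^ (lam l) ≠ 0 := by rw [hstrip]; exact hne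
    refine ⟨hne, ?_⟩
    have hψ : 0 < rowPsiK1 lam (b 0) B x :=
      rowPsiK1_single_pos lam (b 0) B 1 hB hx0 hl1 (by simp only [hBdef, Fin.succ_one_eq_two, mul_neg]; exact neg_pos.2 hpl) hF
    rw [rowPsiK_image8_single_eq lam (b 0) B 1 hB, hcast1, hrootC, zero_mul, zero_add]
    have hQ := sixthOrder_pole_fast_pos hppos hspos hψ
    have e : rowPsiK1 lam (b 0) B x ^ 2 * ((126 * c ^ 4 - 30 * (p ^ 2 + (c - p) ^ 2 + c ^ 2) * c ^ 2
          + 6 * (p ^ 2 * (c - p) ^ 2 + p ^ 2 * c ^ 2 + (c - p) ^ 2 * c ^ 2))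
        + (1680 * c ^ 2 - 120 * (p ^ 2 + (c - p) ^ 2 + c ^ 2)) * rowPsiK1 lam (b 0) B x + 5040 * rowPsiK1 lam (b 0) B x ^ 2)
        = 6 * (12 * p ^ 4 + 56 * p ^ 3 * (c - p) + 89 * p ^ 2 * (c - p) ^ 2 + 56 * p * (c - p) ^ 3 + 12 * (c - p) ^ 4) * rowPsiK1 lam (b 0) B x ^ 2
          + 120 * (12 * p ^ 2 + 26 * p * (c - p) + 12 * (c - p) ^ 2) * rowPsiK1 lam (b 0) B x ^ 3 + 5040 * rowPsiK1 lam (b 0) B x ^ 4 := by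
      ring
    rw [e]; exact hQ

end ProductPlusOne

end Summit.ValiantsHypothesis.ValiantsHypothesis.Theorems.LacunarySymmetroidMatrixDescartes
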